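import Summits.HodgeConjecture.FermatCycles.ThreefoldConditionR
import HarnessLib

/-!
# Fermat cycles — complete residual lists for Shioda's condition `(R³ₘ)` at `m = 23` (kernel exhaustion; companion of `ThreefoldConditionR`)

HONEST FRAMING: explicit algebraic cycles for specific Hodge classes on Fermat/Delsarte varieties;
residual open instances listed; no claim on general Hodge.

For each listed level `m` the COMPLETE list, up to units, of the elements of Shioda's set `I` (level-one characters of the Fermat threefold
`X³ₘ`) that are neither decomposable nor quasi-decomposable (`ResidualWithin m reps`), and for each representative that it lies in `I` and is
neither (`…_spec`). Same machinery as `ThreefoldConditionR` (`residualWithin_of_chunks`, kernel `decide` over chunks of first representatives).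
These lists are the arithmetic input R1 of the cell's refereeable note `run/shared/lean/pub/pub-hfermat/pub-hfermat-lit/GHC3-NOTE.md`
(G-Hodge(X³ₘ, F′¹H³) by P-split pencils / uniruled quotients for `m ≤ 21, 23, 24, 29, 31`; two driver implementations), where every listed
representative carries a certificate; the lists agree with four independent enumerations (lit impl-1/impl-2, referee impl-49, lit-g8
`code/lit/ghc3b`). Nothing geometric is asserted here.

References: [Shioda1983WhatIsKnown] T. Shioda, Adv. Stud. Pure Math. 1 (1983), (13) pp. 63–64; cell files as above.
-/

namespace Summit.HodgeConjecture.FermatCycles.ThreefoldResidualB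

open Multiset
open Literature.AlgebraicGeometry.Shioda1982 Literature.AlgebraicGeometry.Shioda1983
open Summit.HodgeConjecture.FermatCycles.ThreefoldConditionR (cover_one)

/-- residual representatives at `m = 23` (16 unit orbits; census `|I| = 1320`, `968` decomposable, `0` quasi-decomposable only, `352` residual multisets). [folklore] -/
def residualReps_twentyThree : List (Multiset (ZMod 23)) :=
  [{1, 1, 9, 15, 20}, {1, 1, 11, 13, 20}, {1, 1, 11, 15, 18}, {1, 2, 7, 17, 19}, {1, 2, 9, 15, 19}, {1, 2, 10, 15, 18}, {1, 2, 11, 13, 19}, {1, 2, 11, 14, 18}, {1, 3, 4, 17, 21}, {1, 3, 5, 16, 21}, {1, 3, 7, 17, 18}, {1, 3, 10, 14, 18}, {1, 3, 10, 15, 17}, {1, 3, 11, 15, 16}, {1, 4, 6, 14, 21}, {1, 4, 6, 15, 20}]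

set_option maxHeartbeats 0 in
/-- the search at `23`, first representatives `a ∈ [1, 2)`. Kernel. [folklore] -/
theorem check_23_1 : checkP 23 (fun s ↦ IsDecomposable s ∨ IsQuasiDecomposable s ∨ ∃ r ∈ residualReps_twentyThree, ∃ t ∈ unitsList 23, s = r.map (fun x ↦ (t : ZMod 23) * x)) 1 1 = true := by
  decide +kernel

set_option maxHeartbeats 0 in
/-- the search at `23`, first representatives `a ∈ [2, 4)`. Kernel. [folklore] -/
theorem check_23_2 : checkP 23 (fun s ↦ IsDecomposable s ∨ IsQuasiDecomposable s ∨ ∃ r ∈ residualReps_twentyThree, ∃ t ∈ unitsList 23, s = r.map (fun x ↦ (t : ZMod 23) * x)) 2 2 = true := by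
  decide +kernel

set_option maxHeartbeats 0 in
/-- the search at `23`, first representatives `a ∈ [4, 7)`. Kernel. [folklore] -/
theorem check_23_4 : checkP 23 (fun s ↦ IsDecomposable s ∨ IsQuasiDecomposable s ∨ ∃ r ∈ residualReps_twentyThree, ∃ t ∈ unitsList 23, s = r.map (fun x ↦ (t : ZMod 23) * x)) 4 3 = true := by
  decide +kernel

set_option maxHeartbeats 0 in
/-- the search at `23`, first representatives `a ∈ [7, 23)`. Kernel. [folklore] -/
theorem check_23_7 : checkP 23 (fun s ↦ IsDecomposable s ∨ IsQuasiDecomposable s ∨ ∃ r ∈ residualReps_twentyThree, ∃ t ∈ unitsList 23, s = r.map (fun x ↦ (t : ZMod 23) * x)) 7 16 = true := by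
  decide +kernel

/-- **Residual list at `m = 23` is complete**: every element of `I_{23}` is decomposable, quasi-decomposable, or a unit multiple of a listed representative. Kernel exhaustion, 4 chunks. [folklore] -/
theorem residual_twentyThree : ResidualWithin 23 residualReps_twentyThree :=
  residualWithin_of_chunks 23 _ [(1, 1), (2, 2), (4, 3), (7, 16)] (by
    intro a h0 h1
    rcases Nat.lt_or_ge a 2 with hc0 | hc0
    · exact ⟨(1, 1), by simp, by omega, by omega⟩
    rcases Nat.lt_or_ge a 4 with hc1 | hc1
    · exact ⟨(2, 2), by simp, by omega, by omega⟩
    rcases Nat.lt_or_ge a 7 with hc2 | hc2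
    · exact ⟨(4, 3), by simp, by omega, by omega⟩
    exact ⟨(7, 16), by simp, by omega, by omega⟩) (by
    intro p hp
    simp only [List.mem_cons, List.not_mem_nil, or_false] at hp
    rcases hp with rfl | rfl | rfl | rfl
    · exact check_23_1
    · exact check_23_2
    · exact check_23_4
    · exact check_23_7)

set_option maxHeartbeats 0 in
/-- the representatives at `m = 23` lie in `I` and are neither decomposable nor quasi-decomposable. Kernel. [folklore] -/
theorem residualReps_twentyThree_spec :
    ∀ r ∈ residualReps_twentyThree, IsLevelOne r ∧ ¬ IsDecomposable r ∧ ¬ IsQuasiDecomposable r := by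
  decide +kernel

end Summit.HodgeConjecture.FermatCycles.ThreefoldResidualB
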